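import Mathlib
import HarnessLib
import HarnessLib.Audit
import Summits.PneNP.PneNP.Theses.KrwChromaticSteering
import Literature.Computability.Complexity.KRWComposition
import Literature.Computability.Complexity.ConstantDepth
import Literature.Computability.Complexity.Classes
import Literature.Computability.Complexity.CircuitClassesProofs

/-!
# Line `birth` — BC3 skeleton for the crux `CompositionIteration` (stmt-PneNP-18541)

Route `KrwChromaticSteering` (route-PneNP-KrwChromaticSteering), item `CompositionIteration`
(support in the route's own triage, auto-crux by the gate): **the weak KRW conjecture in depth
form (loss `c·(⌊log₂(mn)⌋+1)`, inlined as the hypothesis) yields a language in `P` outside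
non-uniform `NC¹`** — the printed glue "weak KRW ⇒ P ⊄ NC¹" (Karchmer–Raz–Wigderson 1995 §5;
Meir 2023, §1 Prop. 1 "folklore"). Definitionally the crux is `weakKRW → ∃ L ∈ Classes.P, L ∉ NC1` with the conjecture written out
(checked below by an `Iff.rfl` example; the file names no proposition of its own).

THE LINE = the route header's foreseen split ("TWO-LAYER PLAN … CompositionIteration ⇐ KW easy
direction for `NC1` + the KRW95 iteration"), made precise over the tree's objects, with the
`P`-side supplied by the circuit-value language already in the tree. Four named pieces, each a
lemma of the folklore proof, and a real seam:

* `stub_iterate` — THE KRW ITERATION (load-bearing, size L). From weak KRW: for every constant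
  `c₀` there are an inner arity `k ≥ 1`, a number of levels `d` and inner functions
  `g₁, …, g_d : {0,1}^k → {0,1}` such that EVERY Karchmer–Wigderson protocol for the iterated block
  composition `h_d = (⋯((x₀ ⋄ g₁) ⋄ g₂)⋯) ⋄ g_d` on `k^d` bits (`iterComp`, row-major re-indexing by
  `finProdFinEquiv`) has depth `> c₀·(k + d·(⌊log₂ k⌋+1))` — i.e. superlogarithmic in the length
  `≈ d·2^k + k^d` of "truth tables + input". (Induction on levels: weak KRW at `m = k^j`, `n = k`
  gains `k − c·(⌊log₂ k^{j+1}⌋+1)` per level and forces the chosen `g_{j+1}` non-constant while the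
  loss is `< k`; `d = c₀ + 1` levels and `k` large against `c, c₀` suffice.)
* `stub_circuit` — SMALL CIRCUITS FOR ITERATED COMPOSITIONS (size M): `h_d` has a `B₂`-circuit `C`
  with `⌊log₂(k^d + |C|)⌋ ≤ c₃·(k + d·(⌊log₂ k⌋+1))` (a lookup/multiplexer circuit of size `O(2^k)`
  per occurrence of an inner function, `≤ d·k^d` occurrences).
* `stub_cvp` — CVP UNIVERSALITY IN `P` (size M): there is ONE language `L ∈ P` (the tree's
  circuit-evaluation language `CircEval.EvalLang`, Arora–Barak Thm. 6.18) such that every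
  `B₂`-circuit `C` on `n ≥ 1` inputs is a PROJECTION of the slice of `L` at a length `ℓ` with
  `⌊log₂ ℓ⌋ ≤ c₂·(⌊log₂(n + |C|)⌋+1)`: an input embedding `e` (here `x ↦ ⟨x, desc C⟩`, `boolPair`)
  with `L.sliceFn ℓ (e x) = C.eval x`, and a coordinate map `back` such that two embedded inputs
  differ only at coordinates `i` whose preimages `back i` differ (the description part is constant).
* `stub_kw` — KARCHMER–WIGDERSON, CIRCUIT ⟹ PROTOCOL for `B₂`-circuits and the GENERAL game
  (size M; Jukna 2012 Thm. 3.13 / Claim 3.14; not in the tree, which has only the monotone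
  protocol ⟹ formula direction, `KWProtocolFormula`): a `B₂`-circuit `C` computing `h` on `n ≥ 1`
  variables gives a protocol tree for `KW_h` of depth `≤ c₁·acDepth C` (`c₁ = 2`: `∧/∨` cost one
  round, `⊕` two, negations are role swaps and weigh `0` in `acDepth`).
* the SEAM (sorry-free, proved here): unpack `L ∈ NC1` into a `B₂` family of `acDepth ≤ c·⌊log₂ n⌋ + c`
  deciding `L` (`CircuitFamily.Decides.eval_eq`), turn the circuit at the embedding length `ℓ` into
  a protocol (`stub_kw`), pull it back along the projection with `KWTree.comap` (`run_comap`,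
  `depth_comap`) to a protocol for `h_d` of depth `≤ c₁·c·(c₂·(c₃·S+1)+1) ≤ c₀·S`,
  `S = k + d·(⌊log₂ k⌋+1) ≥ 1`, contradicting `stub_iterate` at `c₀ = c₁cc₂c₃ + c₁cc₂ + c₁c`.
* `exists_P_notMem_NC1_of_sigs : <stub₁-sig> → <stub₂-sig> → <stub₃-sig> → <stub₄-sig> → (weakKRW → ∃ L ∈ P,
  L ∉ NC¹)` (explicit hypotheses, conclusion = the crux BODY, definitionally the crux) and THE SKELETON THEOREM
  `CompositionIteration_of : CompositionIteration` — the file's only theorem headed by the route decl BY NAME,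
  proved by feeding the four declared stubs (the only `sorry`s of the file) to `exists_P_notMem_NC1_of_sigs`
  (the shape `ledger skeleton check` keys on: hypotheses = declared stubs by name).

Disproof used: none exists for this crux (`ledger crux ls stmt-PneNP-18541`: no workfiles at
registration, 2026-08-17). Negatives honoured: `ledger negatives --problem PneNP` has no entry on
protocols / KW games / `NC1` (route header, Novelty); no stub is an instance of a landed Negative lemma
(none under `Theorems/CompositionIteration/Negative/`). Typing checklist 4c: (iv) every constant is
`∃ c`-quantified (no hand-picked thresholds); (i)–(iii) n/a. BC3 probes (`bc/probe_crux.lean`,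
`bc/probe_summit.lean`, `bc/probe_rerun.lean` in the seat folder): `stub → CompositionIteration` and
`stub → PneNP` by `first | exact? | simpa [·] | (unfold ·; simpa) | aesop` (maxHeartbeats 400000) FAIL for all
four stubs, 8/8 (the three `aesop` norm-simp timeouts re-run at 1600000 heartbeats: exhaustive-search failures,
unsolved `⊢ CompositionIteration` / `⊢ PneNP`). Planner planner-skel-stmt-PneNP-18541-0, 2026-08-17.
-/

set_option linter.dupNamespace false
set_option linter.unusedVariables false

noncomputable section

namespace Summit.PneNP.PneNP.Cruxes.CompositionIteration.Birth

open Literature.Computability.Complexity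
open Summit.PneNP.PneNP.Theses.KrwChromaticSteering

/-! ## §0 Objects and identification (sorry-free) -/

/-- The crux IS `weakKRW → ∃ L ∈ P, L ∉ NC¹`, `weakKRW` being the weak KRW conjecture in depth
form written out (an open conjecture used ONLY as a hypothesis, exactly as in the route decl; it is
inlined everywhere below rather than named, so that this file defines no proposition of its own).
[cite: Meir2023, §1 Conj. 2 and Prop. 1] -/
example :
    Summit.PneNP.PneNP.Theses.KrwChromaticSteering.CompositionIteration ↔
      ((∃ c : ℕ, ∀ m n : ℕ, 1 ≤ n → ∀ f : (Fin m → Bool) → Bool, (∃ a b, f a ≠ f b) →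
        ∃ g : (Fin n → Bool) → Bool, ∀ P : KWTree (Fin m × Fin n), P.Solves (blockComp f g) →
          ∃ Q : KWTree (Fin m), Q.Solves f ∧ Q.depth + n ≤ P.depth + c * (Nat.log 2 (m * n) + 1)) →
        ∃ L ∈ Classes.P, L ∉ NC1) :=
  Iff.rfl

/-- **Iterated block composition** `h_d` of inner functions `g₁, …, g_d : {0,1}^k → {0,1}`
(`gs : Fin d → _`, `gs ⟨j⟩ = g_{j+1}`): `h₀ = x₀` on `k^0 = 1` bit, `h_{j+1} = h_j ⋄ g_{j+1}` on
`k^{j+1} = k^j·k` bits, the `k^j × k` matrix of `blockComp` being stored row-major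
(`finProdFinEquiv (i, t) = t + k·i`). [cite: KarchmerRazWigderson1995, §5 (iterated composition)] -/
def iterComp (k : ℕ) : (d : ℕ) → (Fin d → ((Fin k → Bool) → Bool)) → (Fin (k ^ d) → Bool) → Bool
  | 0, _, x => x ⟨0, by simp⟩
  | d + 1, gs, x =>
      blockComp (iterComp k d fun i => gs (Fin.castSucc i)) (gs (Fin.last d))
        fun p => x (Fin.cast (pow_succ k d).symm (finProdFinEquiv p))

/-! ## §1 The four registered stubs -/

/-- **Stub 1 (THE KRW ITERATION; load-bearing, size L).** Weak KRW in depth form gives, for every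
constant `c₀`, an inner arity `k ≥ 1`, a number of levels `d` and inner functions `g₁, …, g_d` on `k`
bits such that every protocol tree solving the Karchmer–Wigderson game of the iterated composition
`h_d` on `k^d` bits has depth `> c₀·(k + d·(⌊log₂ k⌋+1))`. Proof sketch: induct on levels with
`m = k^j`, `n = k`; each level gains `k − c·(⌊log₂ k^{j+1}⌋+1) ≥ k − c·((j+1)(⌊log₂ k⌋+1)+1)`; while the
loss is `< k` the inner function returned by weak KRW is non-constant (else the depth-`0` leaf solves
the constant composed game), so `h_{j+1}` is non-constant and the induction continues; `d = c₀ + 1`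
and `k` large against `c·d²` and `c₀·d` finish. [cite: KarchmerRazWigderson1995, §5 Thm. 7–8]
[cite: Meir2023, §1 Prop. 1 (folklore; weak KRW ⇒ P ⊄ NC¹)] -/
theorem stub_iterate :
    (∃ c : ℕ, ∀ m n : ℕ, 1 ≤ n → ∀ f : (Fin m → Bool) → Bool, (∃ a b, f a ≠ f b) →
      ∃ g : (Fin n → Bool) → Bool, ∀ P : KWTree (Fin m × Fin n), P.Solves (blockComp f g) →
        ∃ Q : KWTree (Fin m), Q.Solves f ∧ Q.depth + n ≤ P.depth + c * (Nat.log 2 (m * n) + 1)) →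
    ∀ c₀ : ℕ, ∃ k d : ℕ, ∃ gs : Fin d → ((Fin k → Bool) → Bool), 1 ≤ k ∧
      ∀ P : KWTree (Fin (k ^ d)), P.Solves (iterComp k d gs) →
        c₀ * (k + d * (Nat.log 2 k + 1)) < P.depth := by
  sorry

/-- **Stub 2 (SMALL `B₂`-CIRCUITS FOR ITERATED COMPOSITIONS; size M).** There is `c₃` such that
every iterated composition `h_d` of `d` inner functions on `k ≥ 1` bits is computed by a circuit `C`
over the full binary basis `B₂` with `⌊log₂(k^d + |C|)⌋ ≤ c₃·(k + d·(⌊log₂ k⌋+1))` — e.g. a balanced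
multiplexer (Shannon expansion) of `O(2^k)` gates for each of the `∑_{j<d} k^j ≤ d·k^d` occurrences of
an inner function, wired along the composition tree (`Circuit` composition as in
`Literature/Computability/Complexity/CircuitComposition.lean`). [cite: AroraBarak2009, §6.1 (every
function on k bits has a circuit of size O(2^k)); KarchmerRazWigderson1995, §5] -/
theorem stub_circuit :
    ∃ c₃ : ℕ, ∀ k d : ℕ, 1 ≤ k → ∀ gs : Fin d → ((Fin k → Bool) → Bool),
      ∃ C : Circuit (Fin (k ^ d)), C.IsOver B2 ∧ C.Computes (iterComp k d gs) ∧
        Nat.log 2 (k ^ d + C.size) ≤ c₃ * (k + d * (Nat.log 2 k + 1)) := by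
  sorry

/-- **Stub 3 (CVP UNIVERSALITY IN `P`; size M).** One language `L ∈ P` into whose slices every
`B₂`-circuit embeds as a PROJECTION at polynomially related length: for `C` on `n ≥ 1` inputs there are
`ℓ ≥ 1` with `⌊log₂ ℓ⌋ ≤ c₂·(⌊log₂(n + |C|)⌋+1)`, an input embedding `e` with `L.sliceFn ℓ (e x) = C.eval x`
and a coordinate map `back : Fin ℓ → Fin n` such that embedded inputs differ only at coordinates whose
`back`-preimages differ. Intended witness: the tree's circuit-evaluation language `CircEval.EvalLang`
(`EvalLang_mem_P`, `evalFn_boolPair_desc`, `length_desc_le`), `e x = boolPair (List.ofFn x) (desc C)`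
(each input bit doubled, then the constant separator and description), `back i = ⌊i/2⌋ ⊓ (n−1)`.
[cite: AroraBarak2009, Thm. 6.18 (proof: CKT-EVAL ∈ P)] [cite: KarchmerRazWigderson1995, §5] -/
theorem stub_cvp :
    ∃ L ∈ Classes.P, ∃ c₂ : ℕ, ∀ n : ℕ, 1 ≤ n → ∀ C : Circuit (Fin n), C.IsOver B2 →
      ∃ ℓ : ℕ, 1 ≤ ℓ ∧ Nat.log 2 ℓ ≤ c₂ * (Nat.log 2 (n + C.size) + 1) ∧
        ∃ (e : (Fin n → Bool) → (Fin ℓ → Bool)) (back : Fin ℓ → Fin n),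
          (∀ x, L.sliceFn ℓ (e x) = C.eval x) ∧
          (∀ x y : Fin n → Bool, ∀ i : Fin ℓ, e x i ≠ e y i → x (back i) ≠ y (back i)) := by
  sorry

/-- **Stub 4 (KARCHMER–WIGDERSON, CIRCUIT ⟹ PROTOCOL, general game, `B₂` straight-line circuits;
size M).** There is `c₁` (`= 2` works) such that every circuit over `B₂` on `n ≥ 1` variables computing
`h` yields a protocol tree solving the Karchmer–Wigderson game of `h` of depth `≤ c₁·acDepth C`:
by induction along the gate list, keeping for every wire protocols for the wire function AND its
negation (role swap, `KWTree.swap`); an `∧`-type gate costs one Bob round, an `∨`-type gate one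
Alice round, `⊕`/`⇔` two rounds (`u ⊕ v = (u ∧ ¬v) ∨ (¬u ∧ v)`), constants and projections none;
negation gates weigh `0` in `acDepth` and cost nothing. Not in the tree (only the monotone
protocol ⟹ formula direction is, `KWTree.exists_formula_of_solvesMono`).
[cite: KarchmerWigderson1990, §2 Thm. (d(f) = C(R_f)), direction C(R_f) ≤ d(f)]
[cite: JuknaBFC2012, §3.3 Thm. 3.13, Claim 3.14 (circuit to protocol)] -/
theorem stub_kw :
    ∃ c₁ : ℕ, ∀ n : ℕ, 1 ≤ n → ∀ (C : Circuit (Fin n)) (h : (Fin n → Bool) → Bool),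
      C.IsOver B2 → C.Computes h → ∃ P : KWTree (Fin n), P.Solves h ∧ P.depth ≤ c₁ * C.acDepth := by
  sorry

/-! ## §2 The seam and the composition (sorry-free) -/

/-- **Pull-back of a protocol along a projection.** If `e` embeds the inputs of `h'` into those of
`h` with `h (e x) = h' x`, and embedded inputs differ only where their `back`-preimages differ, then
a protocol for `KW_h` relabelled by `KWTree.comap e e back` solves `KW_{h'}` in the same depth.
[cite: Meir2023, §2.3 (reductions between KW relations)] -/
theorem solves_comap_of_projection {n ℓ : ℕ} {h : (Fin ℓ → Bool) → Bool}
    {h' : (Fin n → Bool) → Bool} {P : KWTree (Fin ℓ)} (hP : P.Solves h)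
    (e : (Fin n → Bool) → (Fin ℓ → Bool)) (back : Fin ℓ → Fin n)
    (he : ∀ x, h (e x) = h' x)
    (hback : ∀ x y : Fin n → Bool, ∀ i : Fin ℓ, e x i ≠ e y i → x (back i) ≠ y (back i)) :
    (P.comap e e back).Solves h' := by
  intro x y hx hy
  rw [KWTree.run_comap]
  refine hback x y _ (hP (e x) (e y) ?_ ?_)
  · rw [he]; exact hx
  · rw [he]; exact hy

/-- **Composition with explicit hypotheses** (BC3 shape `stub₁-sig → stub₂-sig → stub₃-sig →
stub₄-sig → crux body`; the conclusion is the crux's BODY `weakKRW → ∃ L ∈ P, L ∉ NC¹`, definitionally the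
crux, so that `CompositionIteration_of` below is the file's only theorem headed by the crux name — what the
registrar keys on). Given weak KRW, take the `P`-language `L`
of CVP universality; if `L ∈ NC1`, unpack a `B₂` family `(C_n)` with `acDepth C_n ≤ c·⌊log₂ n⌋ + c`
deciding `L`; with `c₀ := c₁cc₂c₃ + c₁cc₂ + c₁c` the iteration stub gives `k, d, gs` whose composed
game needs depth `> c₀·S`, `S = k + d(⌊log₂ k⌋+1)`; the small circuit for `h_d` embeds into the slice
of `L` at a length `ℓ` with `⌊log₂ ℓ⌋ ≤ c₂(c₃ S + 1)`; the `NC1` circuit at length `ℓ` becomes a protocol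
of depth `≤ c₁(c·⌊log₂ ℓ⌋ + c)` (KW), pulled back to a protocol for `h_d` of the same depth
`≤ c₀·S` — contradiction. [cite: KarchmerRazWigderson1995, §5] [cite: Meir2023, §1 Prop. 1] -/
theorem exists_P_notMem_NC1_of_sigs :
    ((∃ c : ℕ, ∀ m n : ℕ, 1 ≤ n → ∀ f : (Fin m → Bool) → Bool, (∃ a b, f a ≠ f b) →
      ∃ g : (Fin n → Bool) → Bool, ∀ P : KWTree (Fin m × Fin n), P.Solves (blockComp f g) →
        ∃ Q : KWTree (Fin m), Q.Solves f ∧ Q.depth + n ≤ P.depth + c * (Nat.log 2 (m * n) + 1)) →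
    ∀ c₀ : ℕ, ∃ k d : ℕ, ∃ gs : Fin d → ((Fin k → Bool) → Bool), 1 ≤ k ∧
      ∀ P : KWTree (Fin (k ^ d)), P.Solves (iterComp k d gs) →
        c₀ * (k + d * (Nat.log 2 k + 1)) < P.depth) →
    (∃ c₃ : ℕ, ∀ k d : ℕ, 1 ≤ k → ∀ gs : Fin d → ((Fin k → Bool) → Bool),
      ∃ C : Circuit (Fin (k ^ d)), C.IsOver B2 ∧ C.Computes (iterComp k d gs) ∧
        Nat.log 2 (k ^ d + C.size) ≤ c₃ * (k + d * (Nat.log 2 k + 1))) →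
    (∃ L ∈ Classes.P, ∃ c₂ : ℕ, ∀ n : ℕ, 1 ≤ n → ∀ C : Circuit (Fin n), C.IsOver B2 →
      ∃ ℓ : ℕ, 1 ≤ ℓ ∧ Nat.log 2 ℓ ≤ c₂ * (Nat.log 2 (n + C.size) + 1) ∧
        ∃ (e : (Fin n → Bool) → (Fin ℓ → Bool)) (back : Fin ℓ → Fin n),
          (∀ x, L.sliceFn ℓ (e x) = C.eval x) ∧
          (∀ x y : Fin n → Bool, ∀ i : Fin ℓ, e x i ≠ e y i → x (back i) ≠ y (back i))) →
    (∃ c₁ : ℕ, ∀ n : ℕ, 1 ≤ n → ∀ (C : Circuit (Fin n)) (h : (Fin n → Bool) → Bool),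
      C.IsOver B2 → C.Computes h → ∃ P : KWTree (Fin n), P.Solves h ∧ P.depth ≤ c₁ * C.acDepth) →
    ((∃ c : ℕ, ∀ m n : ℕ, 1 ≤ n → ∀ f : (Fin m → Bool) → Bool, (∃ a b, f a ≠ f b) →
      ∃ g : (Fin n → Bool) → Bool, ∀ P : KWTree (Fin m × Fin n), P.Solves (blockComp f g) →
        ∃ Q : KWTree (Fin m), Q.Solves f ∧ Q.depth + n ≤ P.depth + c * (Nat.log 2 (m * n) + 1)) →
      ∃ L ∈ Classes.P, L ∉ NC1) := by
  intro hIt hCirc hCVP hKW hweak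
  obtain ⟨c₃, hCirc⟩ := hCirc
  obtain ⟨L, hLP, c₂, hCVP⟩ := hCVP
  obtain ⟨c₁, hKW⟩ := hKW
  refine ⟨L, hLP, fun hLNC => ?_⟩
  -- unpack `L ∈ NC¹`: a `B₂` family of depth `≤ c·⌊log₂ n⌋ + c` deciding `L`
  simp only [NC1, NC, DepthSizeClass, Set.mem_setOf_eq] at hLNC
  obtain ⟨c, p, Cf, hCf, hdec⟩ := hLNC
  -- the iteration, at the constant `c₀` that the upper bounds below cannot beat
  set c₀ : ℕ := c₁ * c * c₂ * c₃ + c₁ * c * c₂ + c₁ * c with hc₀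
  obtain ⟨k, d, gs, hk, hdeep⟩ := hIt hweak c₀
  set S : ℕ := k + d * (Nat.log 2 k + 1) with hS
  have hS1 : 1 ≤ S := le_add_right hk
  -- a small circuit for `h_d` and its embedding into the slice of `L` at length `ℓ`
  obtain ⟨C, hCO, hCc, hCs⟩ := hCirc k d hk gs
  have hkd : 1 ≤ k ^ d := Nat.one_le_pow d k hk
  obtain ⟨ℓ, hℓ, hℓlog, e, back, he, hback⟩ := hCVP (k ^ d) hkd C hCO
  -- the `NC¹` circuit at length `ℓ` computes the slice and becomes a protocol (KW)
  have hcomp : (Cf ℓ).Computes (L.sliceFn ℓ) := fun x => hdec.eval_eq x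
  obtain ⟨P, hP, hPd⟩ := hKW ℓ hℓ (Cf ℓ) (L.sliceFn ℓ) (hCf ℓ).1 hcomp
  -- pull the protocol back along the projection: a protocol for `h_d` of the same depth
  have hQ : (P.comap e e back).Solves (iterComp k d gs) :=
    solves_comap_of_projection hP e back (fun x => (he x).trans (hCc x)) hback
  have hlt : c₀ * S < P.depth := by
    have := hdeep (P.comap e e back) hQ
    rwa [KWTree.depth_comap] at this
  -- the upper bound `P.depth ≤ c₀ * S`
  have hdepth : (Cf ℓ).acDepth ≤ c * Nat.log 2 ℓ + c := by
    have := (hCf ℓ).2.1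
    simpa using this
  have hlog : Nat.log 2 ℓ ≤ c₂ * (c₃ * S + 1) :=
    hℓlog.trans (Nat.mul_le_mul_left c₂ (Nat.add_le_add_right hCs 1))
  have hup : P.depth ≤ c₁ * (c * (c₂ * (c₃ * S + 1)) + c) :=
    calc P.depth ≤ c₁ * (Cf ℓ).acDepth := hPd
      _ ≤ c₁ * (c * Nat.log 2 ℓ + c) := Nat.mul_le_mul_left c₁ hdepth
      _ ≤ c₁ * (c * (c₂ * (c₃ * S + 1)) + c) :=
          Nat.mul_le_mul_left c₁ (Nat.add_le_add_right (Nat.mul_le_mul_left c hlog) c)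
  have hkey : c₁ * (c * (c₂ * (c₃ * S + 1)) + c) ≤ c₀ * S := by
    have e1 : c₁ * (c * (c₂ * (c₃ * S + 1)) + c)
        = (c₁ * c * c₂ * c₃) * S + (c₁ * c * c₂ + c₁ * c) * 1 := by ring
    have e2 : c₀ * S = (c₁ * c * c₂ * c₃) * S + (c₁ * c * c₂ + c₁ * c) * S := by
      rw [hc₀]; ring
    rw [e1, e2]
    exact Nat.add_le_add_left (Nat.mul_le_mul_left _ hS1) _
  exact absurd (lt_of_lt_of_le hlt (hup.trans hkey)) (lt_irrefl _)

/-- **THE SKELETON THEOREM.** The crux `Summit.PneNP.PneNP.Theses.KrwChromaticSteering.CompositionIteration`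
concluded BY NAME from the four DECLARED stubs `stub_iterate`, `stub_circuit`, `stub_cvp`, `stub_kw` (the only
`sorry`s of this file) through the sorry-free composition `exists_P_notMem_NC1_of_sigs` (definitional unfolding
of the crux). [cite: KarchmerRazWigderson1995, §5] [cite: Meir2023, §1 Prop. 1] -/
theorem CompositionIteration_of :
    Summit.PneNP.PneNP.Theses.KrwChromaticSteering.CompositionIteration :=
  exists_P_notMem_NC1_of_sigs stub_iterate stub_circuit stub_cvp stub_kw

end Summit.PneNP.PneNP.Cruxes.CompositionIteration.Birth

end
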